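import Mathlib.Data.Nat.Choose.Multinomial
import Mathlib.Data.Fin.Tuple.Basic
import Mathlib.Algebra.BigOperators.Fin
import Mathlib.Algebra.Order.BigOperators.Group.Finset
import Mathlib.Logic.Function.Basic
import HarnessLib

/-!
# The number of words with prescribed letter counts is the multinomial coefficient — proved

Topic `Literature/Computability/AlgebraicComplexity`.  The counting fact underlying every
laser-method analysis ("`|I_μ| = binom(N, μ)`", Bürgisser–Clausen–Shokrollahi 1997, proof of Thm. 15.41,
p. 381; Alman–Duan–Vassilevska Williams–Xu–Xu–Zhou 2025, §3.9, Lemma 3.3: the number of level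
sequences with a given distribution is a multinomial coefficient) and the method of types
(Cover–Thomas, "Size of a type class `T(P)`", where `|T(P)|` is this number):

* `card_words_eq_multinomial` — for a finite alphabet `α` and `k : α → ℕ` with `∑ k = n`, the number
  of words `w : Fin n → α` in which every letter `v` occurs exactly `k v` times is
  `Nat.multinomial univ k = n! / ∏ (k v)!`.

Proved by induction on `n` (split off the first letter; Pascal's rule for multinomial
coefficients, `sum_multinomial_update_pred`).  Not in Mathlib (which has `Nat.multinomial` and the
multinomial theorem `Finset.sum_pow`, but no word count).  No definitions.

## References

* P. Bürgisser, M. Clausen, M. A. Shokrollahi, *Algebraic Complexity Theory* (1997), proof of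
  Thm. 15.41 (p. 381: `|I_μ| = binom(N, μ)`). [BurgisserClausenShokrollahi1997]
* T. M. Cover, J. A. Thomas, *Elements of Information Theory*, 2nd ed. Thm. 11.1.3 (1st ed.
  Thm. 12.1.3). [CoverThomas2005]
-/

open scoped BigOperators
open Finset

namespace Literature.Computability.AlgebraicComplexity

variable {α : Type*} [DecidableEq α]

/-- Letter counts of `v :: w`: those of `w`, plus one for the letter `v`. [folklore] -/
theorem card_filter_cons_eq (n : ℕ) (v : α) (w : Fin n → α) (u : α) :
    (univ.filter fun t : Fin (n + 1) => (Fin.cons v w : Fin (n + 1) → α) t = u).card =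
      (univ.filter fun t : Fin n => w t = u).card + if v = u then 1 else 0 := by
  rw [card_filter, card_filter, Fin.sum_univ_succ]
  simp only [Fin.cons_zero, Fin.cons_succ]
  rw [add_comm]

variable [Fintype α]

/-- Removing one occurrence of a letter `v` with `k v ≠ 0` from counts summing to `n + 1` leaves
counts summing to `n`. [folklore] -/
theorem sum_update_pred_eq (n : ℕ) (k : α → ℕ) (hk : ∑ v, k v = n + 1) {v : α} (hv : k v ≠ 0) :
    ∑ u, Function.update k v (k v - 1) u = n := by
  have h1 := sum_update_of_mem (mem_univ v) k (k v - 1)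
  have h2 : ∑ u ∈ univ \ {v}, k u + k v = n + 1 := by
    rw [← hk, ← sum_sdiff (subset_univ {v}), sum_singleton]
  rw [h1]
  omega

/-- **Pascal's rule for multinomial coefficients**: if `∑ k = n + 1` then
`binom(n+1; k) = ∑_{v : k v ≠ 0} binom(n; k - e_v)`. [folklore] -/
theorem sum_multinomial_update_pred (n : ℕ) (k : α → ℕ) (hk : ∑ v, k v = n + 1) :
    ∑ v ∈ univ.filter (fun v => k v ≠ 0), Nat.multinomial univ (Function.update k v (k v - 1)) =
      Nat.multinomial univ k := by
  -- `binom(n; k - e_v) · ∏ k! = n! · k v`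
  have key : ∀ v, k v ≠ 0 →
      Nat.multinomial univ (Function.update k v (k v - 1)) * ∏ u, Nat.factorial (k u) =
        Nat.factorial n * k v := by
    intro v hv
    have hspec := Nat.multinomial_spec (univ : Finset α) (Function.update k v (k v - 1))
    rw [sum_update_pred_eq n k hk hv] at hspec
    have hprod : ∏ u, Nat.factorial (k u) =
        k v * ∏ u, Nat.factorial (Function.update k v (k v - 1) u) := by
      rw [← mul_prod_erase univ _ (mem_univ v), ← mul_prod_erase univ _ (mem_univ v), ← mul_assoc]
      congr 1
      · rw [Function.update_self]
        exact (Nat.mul_factorial_pred hv).symm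
      · refine prod_congr rfl fun u hu => ?_
        rw [Function.update_of_ne (ne_of_mem_erase hu)]
    rw [hprod, mul_left_comm, mul_comm (Nat.multinomial _ _) _, hspec, mul_comm]
  -- sum and cancel `∏ k!`
  have hP : 0 < ∏ u, Nat.factorial (k u) := prod_pos fun u _ => Nat.factorial_pos _
  refine Nat.eq_of_mul_eq_mul_right hP ?_
  rw [sum_mul, sum_congr rfl fun v hv => key v (mem_filter.1 hv).2, ← mul_sum,
    sum_filter_ne_zero, hk, mul_comm (Nat.multinomial _ _), Nat.multinomial_spec, hk,
    Nat.factorial_succ, mul_comm]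

/-- **The number of words with prescribed letter counts is the multinomial coefficient**: for
`k : α → ℕ` with `∑ k = n`, `#{w : Fin n → α | ∀ v, #{t | w t = v} = k v} = binom(n; k)`
(`= n!/∏ (k v)!`; BCS p. 381 "`|I_μ| = binom(N, μ)`"). [cite: BurgisserClausenShokrollahi1997, Thm. 15.41 (proof, p. 381)] -/
theorem card_words_eq_multinomial (n : ℕ) (k : α → ℕ) (hk : ∑ v, k v = n) :
    (univ.filter fun w : Fin n → α => ∀ v, (univ.filter fun t => w t = v).card = k v).card =
      Nat.multinomial univ k := by
  induction n generalizing k with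
  | zero =>
    have hk0 : k = 0 := funext fun v => (sum_eq_zero_iff.1 hk) v (mem_univ v)
    subst hk0
    have hmult : Nat.multinomial (univ : Finset α) (0 : α → ℕ) = 1 := by
      have h := Nat.multinomial_spec (univ : Finset α) (0 : α → ℕ)
      simp only [Pi.zero_apply, Nat.factorial_zero, prod_const_one, one_mul, sum_const_zero] at h
      exact h
    rw [hmult, filter_true_of_mem fun w _ v => by simp, card_univ]
    simp
  | succ n ih =>
    -- split off the first letter: `w ↦ (w 0, tail w)`
    have hbij : (univ.filter fun w : Fin (n + 1) → α =>
        ∀ v, (univ.filter fun t => w t = v).card = k v).card =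
        ((univ.filter fun v => k v ≠ 0).sigma fun v => univ.filter fun w : Fin n → α =>
          ∀ u, (univ.filter fun t => w t = u).card = Function.update k v (k v - 1) u).card := by
      refine card_nbij' (fun w => ⟨w 0, Fin.tail w⟩) (fun p => Fin.cons p.1 p.2) ?_ ?_ ?_ ?_
      · intro w hw
        dsimp only
        rw [mem_coe, mem_filter] at hw
        have hw' := hw.2
        have hcons : Fin.cons (w 0) (Fin.tail w) = w := Fin.cons_self_tail w
        have hcnt : ∀ u, (univ.filter fun t : Fin n => Fin.tail w t = u).card +
            (if w 0 = u then 1 else 0) = k u := fun u => by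
          rw [← card_filter_cons_eq, hcons]; exact hw' u
        rw [mem_coe, mem_sigma, mem_filter, mem_filter]
        dsimp only
        refine ⟨⟨mem_univ _, ?_⟩, mem_univ _, fun u => ?_⟩
        · have := hcnt (w 0)
          rw [if_pos rfl] at this
          omega
        · have := hcnt u
          by_cases h : w 0 = u
          · subst h
            rw [if_pos rfl] at this
            rw [Function.update_self]
            omega
          · rw [if_neg h, add_zero] at this
            rw [Function.update_of_ne (Ne.symm h)]
            exact this
      · intro p hp
        dsimp only
        rw [mem_coe, mem_sigma, mem_filter, mem_filter] at hp
        obtain ⟨⟨-, hv⟩, -, hp⟩ := hp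
        rw [mem_coe, mem_filter]
        refine ⟨mem_univ _, fun u => ?_⟩
        rw [card_filter_cons_eq, hp u]
        by_cases h : p.1 = u
        · subst h
          rw [if_pos rfl, Function.update_self]
          omega
        · rw [if_neg h, add_zero, Function.update_of_ne (Ne.symm h)]
      · intro w _
        exact Fin.cons_self_tail w
      · intro p _
        dsimp only
        rw [Fin.cons_zero, Fin.tail_cons]
    rw [hbij, card_sigma, ← sum_multinomial_update_pred n k hk]
    exact sum_congr rfl fun v hv =>
      ih (Function.update k v (k v - 1)) (sum_update_pred_eq n k hk (mem_filter.1 hv).2)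

end Literature.Computability.AlgebraicComplexity
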